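import Literature.Algebra.Homology.ExtAdjunction
import Mathlib.Algebra.Homology.DerivedCategory.Ext.Map
import HarnessLib

/-!
# `Ext.mapExactFunctor` is natural in the exact functor, and compatible with composition

Topic `Algebra/Homology`; namespace `Literature.Algebra.Homology.ExtFunctoriality`.  Pure homological
algebra complementing Mathlib's `Ext.mapExactFunctor` (which has `_mk₀`, `_comp`, `_extClass` but no
naturality in the functor); no named fact, no `sorry`.

* `ext_induction` — **dévissage for `Ext` with enough injectives**: a property of classes
  `x ∈ Extⁿ(A, B)` (fixed `A`, all `B`, `n`) holding for all `mk₀ f` and stable under `y ↦ y ∘ [S]`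
  (`[S] ∈ Ext¹(S.X₃, S.X₁)` the class of a short exact sequence) holds everywhere — every class of
  positive degree is `y ∘ [0 → B → J → Q → 0]` with `J` injective (dimension shifting).
* `mapExactFunctor_natTrans` — for exact additive `F, G : C ⥤ D` and `τ : F ⟶ G`:
  `τ_A ∘ G(x) = F(x) ∘ τ_B` in `Extⁿ(F A, G B)`.
* `mapExactFunctor_comp_functor` — `(F ⋙ G)(x) = G(F(x))`; `mapExactFunctor_id` — `𝟭(x) = x`.

Written for Route A of crux `stmt-BirchSwinnertonDyer-19295` (seat door-c4 gen 13): with `F = 𝟭`,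
`G = Res ⋙ CoInd` and `τ` the unit this is the naturality behind `cores ∘ res = [Γ : U]`
(Harari Theorem 1.48; profinite case §4.3 (3)) on the `Ext` side, and behind the functoriality of
the duality pairing.

## References
* C. A. Weibel, *An introduction to homological algebra*, CUP (1994), §2.4, Exercise 2.4.3 (dimension
  shifting). [Weibel1994]
-/

-- CITATION-FIX (2026-08-27, door-c4 g13; referee V-g52-5 / N-g52-1, held copies): "Harari Prop. 16.17"
-- for `cores ∘ res = [Γ : U]` → Theorem 1.48 (p. 52; profinite §4.3 (3), p. 97); Weibel "§2.5 (dimension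
-- shifting), Lemma 6.3.2" → §2.4, Exercise 2.4.3 (dimension shifting, p. 45; Lemma 6.3.2 is Shapiro's
-- Lemma).  Declarations unchanged.

noncomputable section

universe w w' w'' v v' v'' u u' u''

namespace Literature.Algebra.Homology

namespace ExtFunctoriality

open CategoryTheory CategoryTheory.Limits CategoryTheory.Abelian

variable {C : Type u} [Category.{v} C] [Abelian C] [HasExt.{w} C]

/-! ## §1 Dévissage -/

/-- **Dévissage / dimension-shifting induction for `Ext`** (enough injectives): a property of all
classes `Extⁿ(A, B)` (`A` fixed) that holds for morphisms and is stable under composition with classes of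
short exact sequences holds for every class. [cite: Weibel1994, §2.4, Exercise 2.4.3] -/
theorem ext_induction [EnoughInjectives C] (A : C) (P : ∀ ⦃B : C⦄ ⦃n : ℕ⦄, Ext A B n → Prop)
    (h0 : ∀ ⦃B : C⦄ (f : A ⟶ B), P (Ext.mk₀ f))
    (hδ : ∀ ⦃S : ShortComplex C⦄ (hS : S.ShortExact) ⦃n : ℕ⦄ (y : Ext A S.X₃ n),
      P y → P (y.comp hS.extClass (rfl : n + 1 = n + 1)))
    {B : C} {n : ℕ} (x : Ext A B n) : P x := by
  induction n generalizing B with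
  | zero =>
    have h := h0 (Ext.addEquiv₀ x)
    rwa [Ext.mk₀_addEquiv₀_apply] at h
  | succ n ih =>
    obtain ⟨y, rfl⟩ := AcyclicResolution.extClass_postcomp_surjective A
      (ExtAdjunction.presentation_shortExact B) (rfl : n + 1 = n + 1)
      (fun e => e.eq_zero_of_injective) x
    exact hδ _ y (ih y)

/-! ## §2 Exact functors on short exact sequences, with definitionally transparent terms -/

section Map

variable {D : Type u'} [Category.{v'} D] [Abelian D] [HasExt.{w'} D]
  (F G : C ⥤ D) [F.Additive] [PreservesFiniteLimits F] [PreservesFiniteColimits F]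
  [G.Additive] [PreservesFiniteLimits G] [PreservesFiniteColimits G]

omit [HasExt C] [HasExt D] [PreservesFiniteLimits F] [PreservesFiniteColimits F] in
/-- `F f ≫ F g = 0`. [cite: Weibel1994, §2.4] -/
theorem map_f_comp_map_g (S : ShortComplex C) : F.map S.f ≫ F.map S.g = 0 := by
  rw [← F.map_comp, S.zero, F.map_zero]

/-- `F S` as an explicit short complex (= `S.map F`, with reducible terms). [cite: Weibel1994, §2.4] -/
abbrev mapSC (S : ShortComplex C) : ShortComplex D :=
  ShortComplex.mk (F.map S.f) (F.map S.g) (map_f_comp_map_g F S)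

omit [HasExt C] [HasExt D] in
/-- `F S` is short exact. [cite: Weibel1994, §2.4] -/
theorem mapSC_shortExact {S : ShortComplex C} (hS : S.ShortExact) : (mapSC F S).ShortExact :=
  hS.map_of_exact F

/-- `F [S] = [F S]` (Mathlib's `Ext.mapExactFunctor_extClass`, retyped). [cite: Weibel1994, §2.4] -/
theorem mapExactFunctor_extClass' {S : ShortComplex C} (hS : S.ShortExact) :
    hS.extClass.mapExactFunctor F = (mapSC_shortExact F hS).extClass :=
  (Ext.mapExactFunctor_extClass F hS).trans rfl

variable {F G} in
/-- `τ` on `F S ⟶ G S`. [cite: Weibel1994, §2.4] -/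
abbrev mapSCNatTrans (τ : F ⟶ G) (S : ShortComplex C) : mapSC F S ⟶ mapSC G S where
  τ₁ := τ.app S.X₁
  τ₂ := τ.app S.X₂
  τ₃ := τ.app S.X₃
  comm₁₂ := (τ.naturality S.f).symm
  comm₂₃ := (τ.naturality S.g).symm

variable {F G} in
omit [HasExt C] in
/-- `[F S] ∘ τ₁ = τ₃ ∘ [G S]`. [cite: Weibel1994, §2.4] -/
theorem extClass_natTrans (τ : F ⟶ G) {S : ShortComplex C} (hS : S.ShortExact) :
    (mapSC_shortExact F hS).extClass.comp (Ext.mk₀ (τ.app S.X₁)) (add_zero 1) =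
      (Ext.mk₀ (τ.app S.X₃)).comp (mapSC_shortExact G hS).extClass (zero_add 1) :=
  ShortComplex.ShortExact.extClass_naturality (mapSC_shortExact F hS) (mapSC_shortExact G hS)
    (mapSCNatTrans τ S)

/-! ## §3 Naturality in the functor -/

variable {F G} in
/-- **`Ext.mapExactFunctor` is natural in the exact functor**: for `τ : F ⟶ G` and `x ∈ Extⁿ(A, B)`,
`τ_A ∘ G(x) = F(x) ∘ τ_B` in `Extⁿ(F A, G B)`. [cite: Weibel1994, §2.4, Exercise 2.4.3] -/
theorem mapExactFunctor_natTrans [EnoughInjectives C] (τ : F ⟶ G) {A B : C} {n : ℕ} (x : Ext A B n) :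
    (Ext.mk₀ (τ.app A)).comp (x.mapExactFunctor G) (zero_add n) =
      (x.mapExactFunctor F).comp (Ext.mk₀ (τ.app B)) (add_zero n) := by
  refine ext_induction A (P := fun B n x => (Ext.mk₀ (τ.app A)).comp (x.mapExactFunctor G) (zero_add n)
    = (x.mapExactFunctor F).comp (Ext.mk₀ (τ.app B)) (add_zero n)) (fun B f => ?_)
    (fun S hS n y hy => ?_) x
  · rw [Ext.mapExactFunctor_mk₀, Ext.mapExactFunctor_mk₀, Ext.mk₀_comp_mk₀, Ext.mk₀_comp_mk₀,
      τ.naturality]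
  · change (Ext.mk₀ (τ.app A)).comp (y.mapExactFunctor G) (zero_add n) =
      (y.mapExactFunctor F).comp (Ext.mk₀ (τ.app S.X₃)) (add_zero n) at hy
    rw [Ext.mapExactFunctor_comp, Ext.mapExactFunctor_comp, mapExactFunctor_extClass' F hS,
      mapExactFunctor_extClass' G hS,
      ← Ext.comp_assoc (Ext.mk₀ (τ.app A)) (y.mapExactFunctor G) _ (zero_add n) rfl (by omega), hy,
      Ext.comp_assoc (y.mapExactFunctor F) (Ext.mk₀ (τ.app S.X₃)) _ (add_zero n) (zero_add 1) (by omega),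
      ← extClass_natTrans τ hS,
      ← Ext.comp_assoc (y.mapExactFunctor F) _ (Ext.mk₀ (τ.app S.X₁)) rfl (add_zero 1) (by omega)]

/-- `𝟭 x = x`. [cite: Weibel1994, §2.4, Exercise 2.4.3] -/
theorem mapExactFunctor_id [EnoughInjectives C] {A B : C} {n : ℕ} (x : Ext A B n) :
    x.mapExactFunctor (𝟭 C) = x := by
  refine ext_induction A (P := fun B n x => x.mapExactFunctor (𝟭 C) = x) (fun B f => ?_)
    (fun S hS n y hy => ?_) x
  · exact Ext.mapExactFunctor_mk₀ (𝟭 C) f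
  · change y.mapExactFunctor (𝟭 C) = y at hy
    rw [Ext.mapExactFunctor_comp, hy, mapExactFunctor_extClass' (𝟭 C) hS]
    rfl

end Map

/-! ## §4 Compatibility with composition of exact functors -/

section Comp

variable {D : Type u'} [Category.{v'} D] [Abelian D] [HasExt.{w'} D]
  {E : Type u''} [Category.{v''} E] [Abelian E] [HasExt.{w''} E]
  (F : C ⥤ D) [F.Additive] [PreservesFiniteLimits F] [PreservesFiniteColimits F]
  (G : D ⥤ E) [G.Additive] [PreservesFiniteLimits G] [PreservesFiniteColimits G]

-- The exactness instances of `F ⋙ G` are Mathlib's (non-instance) lemmas `comp_preservesFiniteLimits F G`,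
-- `comp_preservesFiniteColimits F G`; we take them as (propositional) instance arguments.
variable [PreservesFiniteLimits (F ⋙ G)] [PreservesFiniteColimits (F ⋙ G)]

omit [HasExt C] [HasExt D] in
/-- `[ (F ⋙ G) S ] = [ G (F S) ]` (the two explicit short complexes agree definitionally).
[cite: Weibel1994, §2.4] -/
theorem extClass_mapSC_comp {S : ShortComplex C} (hS : S.ShortExact) :
    (mapSC_shortExact (F ⋙ G) hS).extClass =
      (mapSC_shortExact G (mapSC_shortExact F hS)).extClass := rfl

/-- **`(F ⋙ G)(x) = G(F(x))` on `Ext`.** [cite: Weibel1994, §2.4, Exercise 2.4.3] -/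
theorem mapExactFunctor_comp_functor [EnoughInjectives C] {A B : C} {n : ℕ} (x : Ext A B n) :
    x.mapExactFunctor (F ⋙ G) = (x.mapExactFunctor F).mapExactFunctor G := by
  refine ext_induction A (P := fun B n x => x.mapExactFunctor (F ⋙ G) =
    (x.mapExactFunctor F).mapExactFunctor G) (fun B f => ?_) (fun S hS n y hy => ?_) x
  · rw [Ext.mapExactFunctor_mk₀, Ext.mapExactFunctor_mk₀, Ext.mapExactFunctor_mk₀]
    rfl
  · change y.mapExactFunctor (F ⋙ G) = (y.mapExactFunctor F).mapExactFunctor G at hy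
    rw [Ext.mapExactFunctor_comp, Ext.mapExactFunctor_comp, mapExactFunctor_extClass' F hS,
      Ext.mapExactFunctor_comp, mapExactFunctor_extClass' G (mapSC_shortExact F hS),
      mapExactFunctor_extClass' (F ⋙ G) hS, extClass_mapSC_comp F G hS, hy]
    rfl

end Comp

end ExtFunctoriality

end Literature.Algebra.Homology
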